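import Mathlib.NumberTheory.ModularForms.NormTrace
import Mathlib.NumberTheory.ModularForms.CongruenceSubgroups
import Mathlib.NumberTheory.ModularForms.Petersson
import Mathlib.NumberTheory.ModularForms.QExpansion
import Mathlib.NumberTheory.ModularForms.CuspFormSubmodule
import Mathlib.NumberTheory.Modular
import Mathlib.Analysis.Complex.UpperHalfPlane.Measure
import Mathlib.GroupTheory.DoubleCoset
import HarnessLib

-- provenance: harness21/H21/H21/Prelude/EllArithM/HeckeOperators.lean @ 0c3bcbe (interim HEAD d8f2665); M5 mechanical rewrite
/-!
# Hecke operators on modular forms for arithmetic subgroups (trunk EllArithM, item C5)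

We define Hecke operators (double-coset operators `[Γ g Γ']`) on Mathlib's spaces
`ModularForm Γ k` and `CuspForm Γ k`, for `Γ : Subgroup (GL (Fin 2) ℝ)` an arithmetic subgroup
(`Subgroup.IsArithmetic`), entirely in terms of Mathlib's `ModularForm.translate`
(`f ↦ f ∣[k] g`, a form of level `g⁻¹ Γ g`) and `ModularForm.trace` (sum over cosets of a
finite-relative-index pair of levels), see `Mathlib.NumberTheory.ModularForms.NormTrace`.

## Main definitions (namespace `Literature.ModularForms`)

* `Subgroup.isFiniteRelIndex_of_isArithmetic`: two arithmetic subgroups of `GL(2, ℝ)` have finite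
  relative index (deliberately placed in Mathlib's `Subgroup` namespace: it generalises
  `Subgroup.IsArithmetic.isFiniteRelIndexSL`).
* `glCast g`: the image of `g : GL(2, ℚ)` in `GL(2, ℝ)`.
* `heckeCorrespondence Γ Γ' k g : ModularForm Γ k →+ ModularForm Γ' k`: the double coset
  operator `[Γ g Γ'] = trace_{Γ'} ∘ (· ∣[k] g)`; `cuspHeckeCorrespondence` on cusp forms; the
  `ℂ`-linear versions `heckeCorrespondenceₗ`, `cuspHeckeCorrespondenceₗ` for `g ∈ GL(2, ℚ)⁺` and
  levels contained in `SL(2, ℝ)` (`Subgroup.HasDetOne`, needed for the `ℂ`-module structure).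
* `heckeOperator`, `cuspHeckeOperator`, `heckeOperatorₗ`, `cuspHeckeOperatorₗ`: the case `Γ' = Γ`.
* `diagGL a d`: the diagonal matrix `diag(a, d) ∈ GL(2, ℚ)⁺`; `heckeT Γ k p := [Γ diag(1,p) Γ]`
  on cusp forms (`modHeckeT` on modular forms).
* `diamondOp N k d`: the diamond operator `⟨d⟩` on `CuspForm (Gamma1 N) k`.
* `restrictLevel Γ Γ' k`: `[Γ 1 Γ']`, the natural map `S_k(Γ) → S_k(Γ')` (inclusion if `Γ' ≤ Γ`,
  trace if `Γ ≤ Γ'`).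
* `heckeAlgebra Γ k`: the `ℂ`-subalgebra of `End (S_k(Γ))` generated by the `T_p`.
* `peterssonProduct Γ k f g`: the Petersson inner product of two cusp forms.

## Normalisations

* Mathlib's slash action is `(f ∣[k] g)(τ) = σ_g(f(gτ)) |det g|^{k-1} j(g,τ)^{-k}`
  (`ModularForm.slash_def`), which is Diamond–Shurman's `f[g]_k` (Diamond–Shurman, *A first course
  in modular forms*, (5.1)); hence `heckeT Γ k p = [Γ diag(1,p) Γ]` is the arithmetically
  normalised `T_p` with `a_n(T_p f) = a_{pn}(f) + p^{k-1} a_{n/p}(⟨p⟩ f)`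
  (Diamond–Shurman Prop. 5.2.2, 5.3.1); this is recorded as the (sorried) sanity theorem
  `qExpansion_coeff_heckeT`. When `p` divides the level it is the operator usually called `U_p`.
* `peterssonProduct Γ k f g = ∫_{fd} ∑_{a ∈ 𝒮ℒ/(Γ ⊓ 𝒮ℒ)} conj(f(a⁻¹τ)) g(a⁻¹τ) (im a⁻¹τ)^k dμ`,
  where `fd` is the standard fundamental domain of `SL(2, ℤ)` and `μ` is Mathlib's hyperbolic
  `volume` on `ℍ`; the integrand is Mathlib's `UpperHalfPlane.petersson k f g`
  (`= conj (f τ) * g τ * (im τ)^k`). Hence the product is **antilinear in the first argument and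
  linear in the second** (Mathlib / inner-product-space convention), i.e. it is Diamond–Shurman's
  `⟨g, f⟩_Γ` (who integrate `f ḡ yᵏ`), up to the positive volume factor below.
  For `Γ ≤ 𝒮ℒ` (all congruence subgroups used here) it equals `c · ∫_{Γ\ℍ} f̄ g yᵏ dμ` with
  `c = 1` if `-1 ∈ Γ` and `c = 2` otherwise; for a general arithmetic `Γ ≤ SL(2, ℝ)` the sum runs
  over `𝒮ℒ/(Γ ⊓ 𝒮ℒ)`, giving `c · ∫_{(Γ ⊓ 𝒮ℒ)\ℍ}`, i.e. an extra factor `[Γ̄ : (Γ ⊓ 𝒮ℒ)‾]`.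
  There is **no** `1 / V_Γ` volume factor (Diamond–Shurman Def. 5.4.1 divides by the volume
  `V_Γ`). (OUTLINE §4.6.)

## References

* G. Shimura, *Introduction to the arithmetic theory of automorphic functions*, 1971, §3.3–3.4.
* F. Diamond, J. Shurman, *A first course in modular forms*, GTM 228, 2005, Ch. 5.
-/

noncomputable section

open scoped MatrixGroups ModularForm

open ConjAct Pointwise UpperHalfPlane

/-! ### Finite relative index of arithmetic subgroups -/

/-- Two arithmetic subgroups of `GL(2, ℝ)` have finite relative index: `[ℋ : 𝒢 ⊓ ℋ] < ∞`.
This instance is deliberately placed in Mathlib's `Subgroup` namespace, as it generalises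
Mathlib's `Subgroup.IsArithmetic.isFiniteRelIndexSL` (the case `ℋ = 𝒮ℒ`); it follows from
transitivity of commensurability (Shimura 1971, Prop. 3.2 and §3.3). [cite: Shimura1971, Prop. 3.2 and §3.3] -/
instance Subgroup.isFiniteRelIndex_of_isArithmetic (𝒢 ℋ : Subgroup (GL (Fin 2) ℝ))
    [𝒢.IsArithmetic] [ℋ.IsArithmetic] : 𝒢.IsFiniteRelIndex ℋ where
  relIndex_ne_zero :=
    ((Subgroup.IsArithmetic.is_commensurable (𝒢 := 𝒢)).trans
      (Subgroup.IsArithmetic.is_commensurable (𝒢 := ℋ)).symm).1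

namespace Literature.NumberTheory.EllipticCurves.ModularForms

/-! ### Casting `GL(2, ℚ)` into `GL(2, ℝ)` -/

/-- The image of `g : GL(2, ℚ)` in `GL(2, ℝ)` under the entrywise cast `ℚ → ℝ`
(cf. `Subgroup.IsArithmetic.conj` in Mathlib, which uses the same expression). [folklore] -/
abbrev glCast (g : GL (Fin 2) ℚ) : GL (Fin 2) ℝ := g.map (Rat.castHom ℝ)

/-- The image in `GL(2, ℝ)` of `g ∈ GL(2, ℚ)⁺` has positive determinant. [folklore] -/
lemma det_glCast_pos (g : GL(2, ℚ)⁺) : 0 < (glCast (g : GL (Fin 2) ℚ)).det.val := by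
  have : (glCast (g : GL (Fin 2) ℚ)).det.val = ((g : GL (Fin 2) ℚ).det.val : ℝ) := by
    simp [glCast, Matrix.GeneralLinearGroup.map_det]
  rw [this]
  exact_mod_cast g.2

/-- `σ (glCast g)` is the identity for `g ∈ GL(2, ℚ)⁺` (Mathlib's `UpperHalfPlane.σ` is the
identity on matrices of positive determinant). [folklore] -/
@[simp] lemma σ_glCast (g : GL(2, ℚ)⁺) (z : ℂ) : σ (glCast (g : GL (Fin 2) ℚ)) z = z := by
  rw [σ, if_pos (det_glCast_pos g)]
  rfl

/-- The conjugate `g⁻¹ Γ g` of an arithmetic subgroup by `g ∈ GL(2, ℚ)` is arithmetic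
(Mathlib: `Subgroup.IsArithmetic.conj`; restated for the level of `ModularForm.translate f g`). [folklore] -/
instance isArithmetic_conj_glCast_inv (Γ : Subgroup (GL (Fin 2) ℝ)) [Γ.IsArithmetic]
    (g : GL (Fin 2) ℚ) : (toConjAct (glCast g)⁻¹ • Γ).IsArithmetic := by
  simpa [glCast, Matrix.GeneralLinearGroup.map_inv] using Subgroup.IsArithmetic.conj Γ g⁻¹

/-- The conjugate `g⁻¹ Γ g` of a subgroup `Γ ≤ SL(2, ℝ)` is contained in `SL(2, ℝ)`. Not used
in this file; provided as API so that the level `g⁻¹ Γ g` of `ModularForm.translate f g` carries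
Mathlib's `ℂ`-module structure (which needs `HasDetOne`), e.g. for degeneracy maps (item C6). [folklore] -/
instance hasDetOne_conj (Γ : Subgroup (GL (Fin 2) ℝ)) [Γ.HasDetOne]
    (g : ConjAct (GL (Fin 2) ℝ)) : (g • Γ).HasDetOne where
  det_eq {x} hx := by
    rw [Subgroup.mem_pointwise_smul_iff_inv_smul_mem] at hx
    have h := Subgroup.HasDetOne.det_eq hx
    rw [ConjAct.smul_def, map_mul, map_mul, mul_right_comm, ← map_mul, ← map_mul] at h
    simpa using h

/-! ### The generic Hecke correspondence `[Γ g Γ']` -/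

section Correspondence

variable (Γ Γ' : Subgroup (GL (Fin 2) ℝ)) [Γ.IsArithmetic] [Γ'.IsArithmetic] (k : ℤ)

omit [Γ.IsArithmetic] in
/-- Unfolding lemma: the cusp form `CuspForm.translate f g` is the function `f ∣[k] g`
(Mathlib states `CuspForm.coe_translate` only for `g ∈ SL(2, ℤ)`). [folklore] -/
@[simp] lemma coe_cuspForm_translate {F : Type*} [FunLike F ℍ ℂ] [CuspFormClass F Γ k] (f : F)
    (g : GL (Fin 2) ℝ) : (⇑(CuspForm.translate f g) : ℍ → ℂ) = ⇑f ∣[k] g :=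
  rfl

/-- Additivity of Mathlib's `SlashInvariantForm.quotientFunc` in the form (it only depends on the
underlying function, additively). [folklore] -/
lemma quotientFunc_add {𝒢 ℋ : Subgroup (GL (Fin 2) ℝ)} {F : Type*} [FunLike F ℍ ℂ]
    [SlashInvariantFormClass F 𝒢 k] (f₁ f₂ f₃ : F) (h : (⇑f₃ : ℍ → ℂ) = ⇑f₁ + ⇑f₂)
    (q : ℋ ⧸ 𝒢.subgroupOf ℋ) :
    SlashInvariantForm.quotientFunc f₃ q =
      SlashInvariantForm.quotientFunc f₁ q + SlashInvariantForm.quotientFunc f₂ q := by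
  induction q using Quotient.inductionOn with
  | h r => simp [h]

/-- Mathlib's `SlashInvariantForm.quotientFunc` of a form whose underlying function vanishes is
zero. [folklore] -/
lemma quotientFunc_eq_zero {𝒢 ℋ : Subgroup (GL (Fin 2) ℝ)} {F : Type*} [FunLike F ℍ ℂ]
    [SlashInvariantFormClass F 𝒢 k] (f : F) (h : (⇑f : ℍ → ℂ) = 0)
    (q : ℋ ⧸ 𝒢.subgroupOf ℋ) : SlashInvariantForm.quotientFunc f q = 0 := by
  induction q using Quotient.inductionOn with
  | h r => simp [h]

/-- Homogeneity of Mathlib's `SlashInvariantForm.quotientFunc` (for a level `ℋ ≤ SL(2, ℝ)`, where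
the slash action is `ℂ`-linear). [folklore] -/
lemma quotientFunc_smul {𝒢 ℋ : Subgroup (GL (Fin 2) ℝ)} [ℋ.HasDetOne] {F : Type*}
    [FunLike F ℍ ℂ] [SlashInvariantFormClass F 𝒢 k] (c : ℂ) (f₁ f₂ : F)
    (h : (⇑f₂ : ℍ → ℂ) = c • ⇑f₁) (q : ℋ ⧸ 𝒢.subgroupOf ℋ) :
    SlashInvariantForm.quotientFunc f₂ q = c • SlashInvariantForm.quotientFunc f₁ q := by
  induction q using Quotient.inductionOn with
  | h r =>
    have hr : ((r : GL (Fin 2) ℝ) : Matrix (Fin 2) (Fin 2) ℝ).det = 1 := by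
      simpa using congrArg Units.val (Subgroup.HasDetOne.det_eq r.2)
    simp [h, ModularForm.smul_slash, σ, hr]

/-- The **Hecke correspondence** (double coset operator) `[Γ g Γ'] : M_k(Γ) → M_k(Γ')` attached
to two arithmetic subgroups `Γ, Γ'` and `g ∈ GL(2, ℚ)`: `f ↦ Tr_{Γ'}(f ∣[k] g)`, i.e.
`f ↦ ∑ᵢ f ∣[k] αᵢ` where `Γ g Γ' = ⊔ᵢ Γ αᵢ` (Shimura 1971, §3.4, (3.4.4); Diamond–Shurman
Def. 5.1.3). Bundled as an additive monoid hom (it is only conjugate-linear when `det g < 0`);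
see `heckeCorrespondenceₗ` for the `ℂ`-linear version. [cite: Shimura1971, §3.4  (3.4.4] -/
def heckeCorrespondence (g : GL (Fin 2) ℚ) : ModularForm Γ k →+ ModularForm Γ' k where
  toFun f := ModularForm.trace Γ' (ModularForm.translate f (glCast g))
  map_zero' := by
    ext τ
    simp only [ModularForm.coe_trace, ModularForm.zero_apply, Finset.sum_apply]
    refine Finset.sum_eq_zero fun q _ ↦ ?_
    rw [quotientFunc_eq_zero k _ ?_ q, Pi.zero_apply]
    rw [ModularForm.coe_translate, ModularForm.coe_zero, SlashAction.zero_slash]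
  map_add' f₁ f₂ := by
    ext τ
    simp only [ModularForm.coe_trace, ModularForm.add_apply, Finset.sum_apply,
      ← Finset.sum_add_distrib]
    refine Finset.sum_congr rfl fun q _ ↦ ?_
    rw [quotientFunc_add k _ _ _ ?_ q, Pi.add_apply]
    rw [ModularForm.coe_translate, ModularForm.coe_translate, ModularForm.coe_translate,
      ModularForm.coe_add, SlashAction.add_slash]

/-- The Hecke correspondence `[Γ g Γ'] : S_k(Γ) → S_k(Γ')` on cusp forms
(Shimura 1971, §3.4; Diamond–Shurman Def. 5.1.3 and Prop. 5.1.2(c)). [cite: Shimura1971, §3.4] -/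
def cuspHeckeCorrespondence (g : GL (Fin 2) ℚ) : CuspForm Γ k →+ CuspForm Γ' k where
  toFun f := CuspForm.trace Γ' (CuspForm.translate f (glCast g))
  map_zero' := by
    ext τ
    simp only [CuspForm.coe_trace, CuspForm.zero_apply, Finset.sum_apply]
    refine Finset.sum_eq_zero fun q _ ↦ ?_
    rw [quotientFunc_eq_zero k _ ?_ q, Pi.zero_apply]
    rw [coe_cuspForm_translate, CuspForm.coe_zero, SlashAction.zero_slash]
  map_add' f₁ f₂ := by
    ext τ
    simp only [CuspForm.coe_trace, CuspForm.add_apply, Finset.sum_apply,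
      ← Finset.sum_add_distrib]
    refine Finset.sum_congr rfl fun q _ ↦ ?_
    rw [quotientFunc_add k _ _ _ ?_ q, Pi.add_apply]
    rw [coe_cuspForm_translate, coe_cuspForm_translate, coe_cuspForm_translate,
      CuspForm.coe_add, SlashAction.add_slash]

/-- The Hecke correspondence on cusp forms is the restriction of the one on modular forms
(as functions on `ℍ`). [folklore] -/
lemma coe_cuspHeckeCorrespondence (g : GL (Fin 2) ℚ) (f : CuspForm Γ k) :
    (⇑(cuspHeckeCorrespondence Γ Γ' k g f) : ℍ → ℂ) =
      ⇑(heckeCorrespondence Γ Γ' k g (f : ModularForm Γ k)) :=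
  rfl

variable [Γ.HasDetOne] [Γ'.HasDetOne]

/-- The `ℂ`-linear Hecke correspondence `[Γ g Γ'] : M_k(Γ) →ₗ[ℂ] M_k(Γ')` for
`g ∈ GL(2, ℚ)⁺` and levels `Γ, Γ' ≤ SL(2, ℝ)` (Shimura 1971, §3.4; Diamond–Shurman §5.1).
(For `det g < 0` the operator is conjugate-linear, and Mathlib's `ℂ`-module structure on
`ModularForm Γ k` needs `Γ.HasDetOne`; hence the hypotheses.) [cite: Shimura1971, §3.4] -/
def heckeCorrespondenceₗ (g : GL(2, ℚ)⁺) : ModularForm Γ k →ₗ[ℂ] ModularForm Γ' k where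
  __ := heckeCorrespondence Γ Γ' k g
  map_smul' c f := by
    change heckeCorrespondence Γ Γ' k g (c • f) = c • heckeCorrespondence Γ Γ' k g f
    ext τ
    simp only [heckeCorrespondence, AddMonoidHom.coe_mk, ZeroHom.coe_mk, ModularForm.coe_trace,
      ModularForm.IsGLPos.smul_apply, Finset.sum_apply, Finset.smul_sum]
    refine Finset.sum_congr rfl fun q _ ↦ ?_
    rw [quotientFunc_smul k c (ModularForm.translate f (glCast g)) _ ?_ q, Pi.smul_apply]
    rw [ModularForm.coe_translate, ModularForm.coe_translate, ModularForm.IsGLPos.coe_smul,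
      ModularForm.smul_slash]
    ext z
    simp

/-- The `ℂ`-linear Hecke correspondence `[Γ g Γ'] : S_k(Γ) →ₗ[ℂ] S_k(Γ')` on cusp forms, for
`g ∈ GL(2, ℚ)⁺` and levels `Γ, Γ' ≤ SL(2, ℝ)` (Shimura 1971, §3.4; Diamond–Shurman §5.1). [cite: Shimura1971, §3.4] -/
def cuspHeckeCorrespondenceₗ (g : GL(2, ℚ)⁺) : CuspForm Γ k →ₗ[ℂ] CuspForm Γ' k where
  __ := cuspHeckeCorrespondence Γ Γ' k g
  map_smul' c f := by
    change cuspHeckeCorrespondence Γ Γ' k g (c • f) = c • cuspHeckeCorrespondence Γ Γ' k g f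
    ext τ
    simp only [cuspHeckeCorrespondence, AddMonoidHom.coe_mk, ZeroHom.coe_mk, CuspForm.coe_trace,
      CuspForm.IsGLPos.smul_apply, Finset.sum_apply, Finset.smul_sum]
    refine Finset.sum_congr rfl fun q _ ↦ ?_
    rw [quotientFunc_smul k c (CuspForm.translate f (glCast g)) _ ?_ q, Pi.smul_apply]
    rw [coe_cuspForm_translate, coe_cuspForm_translate, CuspForm.IsGLPos.coe_smul,
      ModularForm.smul_slash]
    ext z
    simp

end Correspondence

/-! ### Hecke operators (`Γ' = Γ`) -/

section Operator

variable (Γ : Subgroup (GL (Fin 2) ℝ)) [Γ.IsArithmetic] (k : ℤ)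

/-- The Hecke (double coset) operator `[Γ g Γ]` on `M_k(Γ)`, `g ∈ GL(2, ℚ)`
(Shimura 1971, (3.4.4); Diamond–Shurman Def. 5.1.3): the case `Γ' = Γ` of
`heckeCorrespondence`. [cite: Shimura1971, (3.4.4] -/
abbrev heckeOperator (g : GL (Fin 2) ℚ) : ModularForm Γ k →+ ModularForm Γ k :=
  heckeCorrespondence Γ Γ k g

/-- The Hecke (double coset) operator `[Γ g Γ]` on `S_k(Γ)`, `g ∈ GL(2, ℚ)`
(Shimura 1971, (3.4.4); Diamond–Shurman Def. 5.1.3 and Prop. 5.1.2(c)). [cite: Shimura1971, (3.4.4] -/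
abbrev cuspHeckeOperator (g : GL (Fin 2) ℚ) : CuspForm Γ k →+ CuspForm Γ k :=
  cuspHeckeCorrespondence Γ Γ k g

variable [Γ.HasDetOne]

/-- The `ℂ`-linear Hecke operator `[Γ g Γ]` on `M_k(Γ)` for `g ∈ GL(2, ℚ)⁺`, `Γ ≤ SL(2, ℝ)`
(Shimura 1971, (3.4.4); Diamond–Shurman Def. 5.1.3). [cite: Shimura1971, (3.4.4] -/
abbrev heckeOperatorₗ (g : GL(2, ℚ)⁺) : ModularForm Γ k →ₗ[ℂ] ModularForm Γ k :=
  heckeCorrespondenceₗ Γ Γ k g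

/-- The `ℂ`-linear Hecke operator `[Γ g Γ]` on `S_k(Γ)` for `g ∈ GL(2, ℚ)⁺`, `Γ ≤ SL(2, ℝ)`
(Shimura 1971, (3.4.4); Diamond–Shurman Def. 5.1.3). [cite: Shimura1971, (3.4.4] -/
abbrev cuspHeckeOperatorₗ (g : GL(2, ℚ)⁺) : CuspForm Γ k →ₗ[ℂ] CuspForm Γ k :=
  cuspHeckeCorrespondenceₗ Γ Γ k g

end Operator

/-! ### The operators `T_p`, `⟨d⟩`, level restriction, the Hecke algebra -/

/-- The diagonal matrix `diag(a, d)` as an element of `GL(2, ℚ)⁺`, for positive rationals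
`a, d` (Diamond–Shurman §5.1–5.2 use `diag(1, p)`, `diag(d, 1)`, `diag(1, d)`). [folklore] -/
def diagGL (a d : ℚ) (ha : 0 < a) (hd : 0 < d) : GL(2, ℚ)⁺ :=
  ⟨Matrix.GeneralLinearGroup.mkOfDetNeZero !![a, 0; 0, d]
      (by simp [Matrix.det_fin_two, ha.ne', hd.ne']),
    by simp [Matrix.det_fin_two, ha, hd]⟩

/-- The underlying matrix of `diagGL a d`. [folklore] -/
@[simp] lemma coe_coe_diagGL (a d : ℚ) (ha : 0 < a) (hd : 0 < d) :
    ((diagGL a d ha hd : GL (Fin 2) ℚ) : Matrix (Fin 2) (Fin 2) ℚ) = !![a, 0; 0, d] :=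
  rfl

/-- The embedding `SL(2, ℤ) →* GL(2, ℚ)⁺` (entrywise cast). [folklore] -/
def slToGLPos : SL(2, ℤ) →* GL(2, ℚ)⁺ :=
  Matrix.SpecialLinearGroup.toGLPos.comp (Matrix.SpecialLinearGroup.map (Int.castRingHom ℚ))

section T

variable (Γ : Subgroup (GL (Fin 2) ℝ)) [Γ.IsArithmetic] [Γ.HasDetOne] (k : ℤ)

/-- The Hecke operator `T_p := [Γ diag(1, p) Γ]` on cusp forms `S_k(Γ)` (`p ≠ 0` a natural
number, in practice a prime). Because Mathlib's slash action carries the factor `|det|^{k-1}`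
(`ModularForm.slash_def`), this is the *arithmetically normalised* operator with
`a_n(T_p f) = a_{pn}(f) + p^{k-1} a_{n/p}(⟨p⟩ f)` for `p ∤ N` at level `Γ₁(N)`
(Diamond–Shurman (5.2), Prop. 5.2.1, 5.2.2, 5.3.1). When `p` divides the level it is the operator
usually denoted `U_p` (`a_n(U_p f) = a_{pn}(f)`).

**Warning.** Only for `p` prime is this the classical Hecke operator. For composite `n` the single
double coset `[Γ diag(1, n) Γ]` is *not* `T_n` (e.g. `T_{p²} = [Γ diag(1,p²) Γ] + [Γ diag(p,p) Γ]`,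
Diamond–Shurman §5.3); this file only provides `T_p` / `U_p` for primes, which is what the
downstream statements (eigenvalues `a_p`) need. See `heckeT_mul_of_coprime` for the coprime
multiplicativity that does hold for the single double coset. [folklore] -/
def heckeT (p : ℕ) [NeZero p] : Module.End ℂ (CuspForm Γ k) :=
  cuspHeckeOperatorₗ Γ k (diagGL 1 p one_pos (Nat.cast_pos.mpr (NeZero.pos p)))

/-- The Hecke operator `T_p := [Γ diag(1, p) Γ]` on modular forms `M_k(Γ)` (see `heckeT` for the
normalisation and the warning that this is the classical `T_p` only for `p` prime;
Diamond–Shurman (5.2), Prop. 5.2.1). [folklore] -/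
def modHeckeT (p : ℕ) [NeZero p] : Module.End ℂ (ModularForm Γ k) :=
  heckeOperatorₗ Γ k (diagGL 1 p one_pos (Nat.cast_pos.mpr (NeZero.pos p)))

/-- The **Hecke algebra** of level `Γ` and weight `k`: the (commutative, for congruence
subgroups) `ℂ`-subalgebra of `End_ℂ(S_k(Γ))` generated by the operators `T_p = heckeT Γ k p` for
all primes `p` (Diamond–Shurman §5.3). **Design choice:** this deliberately *excludes* the diamond
operators `⟨d⟩`; so for `Γ = Γ₁(N)` it is in general smaller than Diamond–Shurman's
`𝕋_ℂ = ℂ[{T_n, ⟨n⟩}]`, while for `Γ = Γ₀(N)` (trivial character, `⟨d⟩ = 1`) it is the algebra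
generated by the `T_p`, `U_p`. The statement `heckeAlgebra_commutative` is unaffected. [folklore] -/
def heckeAlgebra : Subalgebra ℂ (Module.End ℂ (CuspForm Γ k)) :=
  Algebra.adjoin ℂ (Set.range fun p : Nat.Primes ↦
    haveI : NeZero (p : ℕ) := ⟨p.2.ne_zero⟩
    heckeT Γ k p)

/-- `T_p ∈ heckeAlgebra Γ k` for `p` prime (by definition). [folklore] -/
lemma heckeT_mem_heckeAlgebra (p : ℕ) [NeZero p] (hp : p.Prime) :
    heckeT Γ k p ∈ heckeAlgebra Γ k :=
  Algebra.subset_adjoin ⟨⟨p, hp⟩, rfl⟩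

end T

section Restrict

variable (Γ Γ' : Subgroup (GL (Fin 2) ℝ)) [Γ.IsArithmetic] [Γ.HasDetOne] [Γ'.IsArithmetic]
  [Γ'.HasDetOne] (k : ℤ)

/-- Change of level `S_k(Γ) →ₗ[ℂ] S_k(Γ')` between two arithmetic subgroups: the Hecke
correspondence `[Γ 1 Γ']`, i.e. `f ↦ ∑_{γ ∈ (Γ ⊓ Γ')\Γ'} f ∣[k] γ`. For `Γ' ≤ Γ` the sum has one
term and this is the natural inclusion `S_k(Γ) ↪ S_k(Γ')` (`restrictLevel_apply_coe`); for
`Γ ≤ Γ'` it is the trace map (Diamond–Shurman §5.1 and Ex. 5.1.4; Shimura 1971, §3.4). [cite: Shimura1971, §3.4] -/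
def restrictLevel : CuspForm Γ k →ₗ[ℂ] CuspForm Γ' k :=
  cuspHeckeCorrespondenceₗ Γ Γ' k 1

/-- For `Γ' ≤ Γ`, `restrictLevel Γ Γ' k f` is `f` regarded as a form of the smaller level
(the trace is over the one-point quotient `Γ' / (Γ ⊓ Γ')`). [cite: DiamondShurman2005, §5.1 (forms of level Γ are forms of every smaller level)] -/
def restrictLevel_apply_coe : Prop :=
  ∀ (h : Γ' ≤ Γ) (f : CuspForm Γ k),
    (⇑(restrictLevel Γ Γ' k f) : ℍ → ℂ) = ⇑f

end Restrict

section Diamond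

open CongruenceSubgroup

variable (N : ℕ) [NeZero N] (k : ℤ)

-- Binder repair (2026-08-16): the header instance deliberately shadows the section's, which a
-- `def` does not capture (it ranged too widely before); the overlapping-instances linter is moot.
set_option linter.overlappingInstances false in
/-- Every unit of `ZMod N` is the lower-right entry of a matrix in `Γ₀(N)`
(Diamond–Shurman §5.2, surjectivity of `Γ₀(N) → (ℤ/Nℤ)ˣ`; Mathlib: `Gamma0Map`). [cite: DiamondShurman2005, §5.2 (surjectivity of Γ₀(N) → (ℤ/Nℤ)ˣ)]
(Binder repair 2026-08-16: `[NeZero N]` is written in the header so that it is a parameter of the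
elaborated constant; as a section instance unused by the body it was silently dropped, so the fact
ranged over cases the printed theorem excludes.) -/
def exists_gamma0Map_eq [NeZero N] : Prop :=
  ∀ {d : ZMod N} (hd : IsUnit d),
    ∃ γ : Gamma0 N, Gamma0Map N γ = d

/-- Discharge of `exists_gamma0Map_eq`: the map `Γ₀(N) → (ℤ/Nℤ)ˣ`, `(a b; c d) ↦ d (mod N)`, is
surjective (Diamond–Shurman, *A first course in modular forms*, §5.2, p. 168, first display after
the definitions of `Γ₀(N)`, `Γ₁(N)`; stated there without proof). Proof: lift the unit `d` to
`m = d.val ∈ ℕ`, coprime to `N`; Bézout gives `A m + B N = 1`, and `(A -B; N m) ∈ Γ₀(N)` has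
lower-right entry `m ≡ d`. [cite: DiamondShurman2005, §5.2, p. 168] -/
theorem exists_gamma0Map_eq_holds : exists_gamma0Map_eq N := by
  intro d hd
  set m : ℕ := d.val with hm_def
  have hmd : (m : ZMod N) = d := ZMod.natCast_zmod_val d
  have hm : m.Coprime N := by
    rw [← ZMod.isUnit_iff_coprime, hmd]
    exact hd
  have hbez : (m : ℤ) * Nat.gcdA m N + (N : ℤ) * Nat.gcdB m N = 1 := by
    rw [← Nat.gcd_eq_gcd_ab, hm.gcd_eq_one, Nat.cast_one]
  let A : Matrix (Fin 2) (Fin 2) ℤ := !![Nat.gcdA m N, -Nat.gcdB m N; N, m]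
  have hdet : A.det = 1 := by
    rw [Matrix.det_fin_two_of]
    linear_combination hbez
  let γ : SL(2, ℤ) := ⟨A, hdet⟩
  have hγ : γ ∈ Gamma0 N := by
    simp [Gamma0_mem, γ, A]
  refine ⟨⟨γ, hγ⟩, ?_⟩
  simp [Gamma0Map, γ, A, hmd]

open Classical in
/-- The **diamond operator** `⟨d⟩` on `S_k(Γ₁(N))` for `d : ZMod N`: `f ↦ f ∣[k] γ` for any
`γ = (a b; c δ) ∈ Γ₀(N)` with `δ ≡ d (mod N)`, realised as the Hecke operator `[Γ₁(N) γ Γ₁(N)]`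
(`Γ₁(N)` is normal in `Γ₀(N)`, so the double coset is a single coset). If `d` is not a unit no
such `γ` exists and we return the identity as a junk value (Diamond–Shurman §5.2, p. 168). [folklore] -/
def diamondOp (d : ZMod N) : Module.End ℂ (CuspForm (Gamma1 N) k) :=
  if h : ∃ γ : Gamma0 N, Gamma0Map N γ = d then
    cuspHeckeOperatorₗ (Gamma1 N) k (slToGLPos h.choose)
  else LinearMap.id

/-- `⟨d e⟩ = ⟨d⟩ ⟨e⟩` for units `d, e` (Diamond–Shurman §5.2, p. 168: `d ↦ ⟨d⟩` is a
representation of `(ℤ/Nℤ)ˣ`). [cite: DiamondShurman2005, §5.2 (diamond operators as a representation of (ℤ/Nℤ)ˣ)] -/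
def diamondOp_mul : Prop :=
  ∀ {d e : ZMod N} (hd : IsUnit d) (he : IsUnit e),
    diamondOp N k (d * e) = diamondOp N k d * diamondOp N k e

end Diamond

/-! ### The Petersson inner product -/

section Petersson

open MeasureTheory

variable (Γ : Subgroup (GL (Fin 2) ℝ)) [Γ.IsArithmetic] [Γ.HasDetOne] (k : ℤ)

/-- The **Petersson inner product** of two cusp forms of level `Γ` (arithmetic, `Γ ≤ SL(2, ℝ)`):
`peterssonProduct Γ k f g = ∫_{fd} ∑_{a ∈ 𝒮ℒ/(Γ ⊓ 𝒮ℒ)} P(a⁻¹ τ) dμ(τ)` where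
`P(τ) = conj(f(τ)) g(τ) (im τ)^k` is Mathlib's `UpperHalfPlane.petersson k f g τ`, `fd` is the
standard fundamental domain for `SL(2, ℤ)` (`ModularGroup.fd`) and `μ` is the invariant measure
`volume` on `ℍ`. The summand is well defined on cosets by `SlashInvariantFormClass.petersson_smul`.
**Convention:** antilinear in the first argument `f`, linear in the second `g` (Mathlib's
inner-product convention); this is Diamond–Shurman's `⟨g, f⟩_Γ` (Def. 5.4.1, integrand `f ḡ yᵏ`)
up to a positive factor. For `Γ ≤ 𝒮ℒ`, since `⋃_a a⁻¹ • fd` covers `Γ\ℍ` once (twice if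
`-1 ∉ Γ`), this is `c ∫_{Γ\ℍ} f̄ g yᵏ dμ` with `c ∈ {1, 2}`; for general arithmetic `Γ` there is
an extra index factor `[Γ̄ : (Γ ⊓ 𝒮ℒ)‾]`. There is *no* volume normalisation `1/V_Γ`
(Diamond–Shurman Def. 5.4.1); see the module docstring. [folklore] -/
def peterssonProduct (f g : CuspForm Γ k) : ℂ :=
  letI := Fintype.ofFinite (𝒮ℒ ⧸ Γ.subgroupOf 𝒮ℒ)
  ∫ τ in ModularGroup.fd, ∑ q : 𝒮ℒ ⧸ Γ.subgroupOf 𝒮ℒ,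
    Quotient.liftOn' q (fun a ↦ petersson k ⇑f ⇑g ((a : GL (Fin 2) ℝ)⁻¹ • τ))
      (fun a b hab ↦ by
        rw [QuotientGroup.leftRel_apply, Subgroup.mem_subgroupOf] at hab
        have : ((b : GL (Fin 2) ℝ))⁻¹ • τ =
            ((a⁻¹ * b : 𝒮ℒ) : GL (Fin 2) ℝ)⁻¹ • ((a : GL (Fin 2) ℝ)⁻¹ • τ) := by
          rw [← mul_smul, Subgroup.coe_mul, Subgroup.coe_inv, mul_inv_rev, inv_inv,
            mul_inv_cancel_right]
        simp only [this, SlashInvariantFormClass.petersson_smul (inv_mem hab)])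

/-- The Petersson integrand of two cusp forms is integrable on the standard fundamental domain
(Diamond–Shurman §5.4, convergence of (5.10) for cusp forms). [cite: DiamondShurman2005, §5.4 (convergence of (5.10))] -/
def integrableOn_petersson : Prop :=
  ∀ (f g : CuspForm Γ k),
    IntegrableOn (fun τ ↦ petersson k ⇑f ⇑g τ) ModularGroup.fd

/-- Hermitian symmetry of the Petersson product: `⟨g, f⟩ = conj ⟨f, g⟩`
(Diamond–Shurman §5.4, p. 183). [cite: DiamondShurman2005, §5.4] -/
def peterssonProduct_conj_symm : Prop :=
  ∀ (f g : CuspForm Γ k),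
    peterssonProduct Γ k g f = starRingEnd ℂ (peterssonProduct Γ k f g)

end Petersson

/-! ### Structural theorems (proofs deferred) -/

section Theorems

open CongruenceSubgroup

/-- **Double coset formula.** If `Γ g Γ' = ⊔ᵢ Γ αᵢ` (finite disjoint union of right cosets),
then `[Γ g Γ'] f = ∑ᵢ f ∣[k] αᵢ` (Shimura 1971, Prop. 3.1 and (3.4.4); Diamond–Shurman
Def. 5.1.3 with Lemma 5.1.2). The hypotheses say: every `αᵢ` lies in `Γ g Γ'` (`hα`) and every
`x ∈ Γ g Γ'` lies in exactly one right coset `Γ αᵢ` (`hα'`), i.e. `Γ g Γ' = ⊔ᵢ Γ αᵢ`. [cite: Shimura1971, Prop. 3.1 and (3.4.4] -/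
def heckeCorrespondence_apply_eq_sum_slash : Prop :=
  ∀ (Γ Γ' : Subgroup (GL (Fin 2) ℝ)) [Γ.IsArithmetic] [Γ'.IsArithmetic] (k : ℤ) (g : GL (Fin 2) ℚ) {ι : Type*} [Fintype ι] (α : ι → GL (Fin 2) ℝ) (hα : ∀ i, α i ∈ DoubleCoset.doubleCoset (glCast g) (Γ : Set (GL (Fin 2) ℝ)) Γ') (hα' : ∀ x ∈ DoubleCoset.doubleCoset (glCast g) (Γ : Set (GL (Fin 2) ℝ)) Γ', ∃! i, x * (α i)⁻¹ ∈ Γ) (f : ModularForm Γ k),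
    (⇑(heckeCorrespondence Γ Γ' k g f) : ℍ → ℂ) = ∑ i, ⇑f ∣[k] α i

/-- **Double coset formula** for the Hecke operator: if `Γ g Γ = ⊔ᵢ Γ αᵢ` (each `αᵢ ∈ Γ g Γ`,
each element of `Γ g Γ` in exactly one `Γ αᵢ`) then
`[Γ g Γ] f = ∑ᵢ f ∣[k] αᵢ` (Shimura 1971, (3.4.4); Diamond–Shurman (5.1)). [cite: Shimura1971, (3.4.4] -/
def heckeOperator_apply_eq_sum_slash : Prop :=
  ∀ (Γ : Subgroup (GL (Fin 2) ℝ)) [Γ.IsArithmetic] (k : ℤ) (g : GL (Fin 2) ℚ) {ι : Type*} [Fintype ι] (α : ι → GL (Fin 2) ℝ) (hα : ∀ i, α i ∈ DoubleCoset.doubleCoset (glCast g) (Γ : Set (GL (Fin 2) ℝ)) Γ) (hα' : ∀ x ∈ DoubleCoset.doubleCoset (glCast g) (Γ : Set (GL (Fin 2) ℝ)) Γ, ∃! i, x * (α i)⁻¹ ∈ Γ) (f : ModularForm Γ k),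
    (⇑(heckeOperator Γ k g f) : ℍ → ℂ) = ∑ i, ⇑f ∣[k] α i

/- interim proof relied on results that are now named facts (D-0014); demoted to a fact by the M5 import, proof preserved:
:=
  heckeCorrespondence_apply_eq_sum_slash Γ Γ k g α hα hα' f
-/

variable (N : ℕ) [NeZero N] (k : ℤ)

/-- The Hecke operators `T_p`, `T_q` on `S_k(Γ₁(N))` commute (Diamond–Shurman Prop. 5.2.4). [cite: DiamondShurman2005, Prop. 5.2.4] -/
def heckeT_comm : Prop :=
  ∀ (p q : ℕ) [NeZero p] [NeZero q],
    heckeT (Gamma1 N) k p * heckeT (Gamma1 N) k q =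
      heckeT (Gamma1 N) k q * heckeT (Gamma1 N) k p

/-- The Hecke operators `T_p`, `T_q` on `S_k(Γ₀(N))` commute (Diamond–Shurman Prop. 5.2.4 and
§5.2, `S_k(Γ₀(N)) = S_k(N, 𝟙)`). [cite: DiamondShurman2005, Prop. 5.2.4] -/
def heckeT_comm_gamma0 : Prop :=
  ∀ (p q : ℕ) [NeZero p] [NeZero q],
    heckeT (Gamma0 N) k p * heckeT (Gamma0 N) k q =
      heckeT (Gamma0 N) k q * heckeT (Gamma0 N) k p

/-- Coprime multiplicativity of the double coset operators `[Γ₀(N) diag(1, ·) Γ₀(N)]`: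
`[diag(1, mn)] = [diag(1, m)] [diag(1, n)]` for `m, n` coprime (Shimura 1971, Prop. 3.7 /
(3.3.5); Diamond–Shurman Prop. 5.2.4). This holds for the single double coset even though
`heckeT Γ k n` is not the classical `T_n` for composite `n`. [cite: Shimura1971, Prop. 3.7 / (3.3.5] -/
def heckeT_mul_of_coprime : Prop :=
  ∀ (m n : ℕ) [NeZero m] [NeZero n] (h : m.Coprime n),
    heckeT (Gamma0 N) k (m * n) = heckeT (Gamma0 N) k m * heckeT (Gamma0 N) k n

/-- Coprime multiplicativity of `[Γ₁(N) diag(1, ·) Γ₁(N)]` on `S_k(Γ₁(N))`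
(Shimura 1971, Prop. 3.7; Diamond–Shurman Prop. 5.2.4). [cite: Shimura1971, Prop. 3.7] -/
def heckeT_mul_of_coprime_gamma1 : Prop :=
  ∀ (m n : ℕ) [NeZero m] [NeZero n] (h : m.Coprime n),
    heckeT (Gamma1 N) k (m * n) = heckeT (Gamma1 N) k m * heckeT (Gamma1 N) k n

/-- `T_p` commutes with the diamond operators on `S_k(Γ₁(N))` (Diamond–Shurman Prop. 5.2.4). [cite: DiamondShurman2005, Prop. 5.2.4] -/
def heckeT_diamondOp_comm : Prop :=
  ∀ (p : ℕ) [NeZero p] (d : ZMod N),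
    heckeT (Gamma1 N) k p * diamondOp N k d = diamondOp N k d * heckeT (Gamma1 N) k p

/-- **`q`-expansion of `T_p`** at level `Γ₀(N)` (trivial character): for `p` prime,
`a_n(T_p f) = a_{pn}(f) + 𝟙_N(p) p^{k-1} a_{n/p}(f)`, where `𝟙_N(p) = 0` if `p ∣ N` and the
last term is `0` unless `p ∣ n` (Diamond–Shurman Prop. 5.2.2(a), Prop. 5.3.1). This pins down
the normalisation of `heckeT`. [cite: DiamondShurman2005, Prop. 5.2.2(a) and Prop. 5.3.1] -/
def qExpansion_coeff_heckeT : Prop :=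
  ∀ (f : CuspForm (Gamma0 N) k) (p : ℕ) [NeZero p] (hp : p.Prime) (n : ℕ),
    (qExpansion 1 ⇑(heckeT (Gamma0 N) k p f)).coeff n =
      (qExpansion 1 ⇑f).coeff (p * n) +
        (if p ∣ N then 0
         else (p : ℂ) ^ (k - 1) * (if p ∣ n then (qExpansion 1 ⇑f).coeff (n / p) else 0))

/-- **`q`-expansion of `T_p`** at level `Γ₁(N)`: for `p` prime,
`a_n(T_p f) = a_{pn}(f) + 𝟙_N(p) p^{k-1} a_{n/p}(⟨p⟩ f)`
(Diamond–Shurman Prop. 5.2.2(a), Prop. 5.3.1). [cite: DiamondShurman2005, Prop. 5.2.2(a) and Prop. 5.3.1] -/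
def qExpansion_coeff_heckeT_gamma1 : Prop :=
  ∀ (f : CuspForm (Gamma1 N) k) (p : ℕ) [NeZero p] (hp : p.Prime) (n : ℕ),
    (qExpansion 1 ⇑(heckeT (Gamma1 N) k p f)).coeff n =
      (qExpansion 1 ⇑f).coeff (p * n) +
        (if p ∣ N then 0
         else (p : ℂ) ^ (k - 1) *
          (if p ∣ n then (qExpansion 1 ⇑(diamondOp N k p f)).coeff (n / p) else 0))

/-- **Self-adjointness of `T_p`** on `S_k(Γ₀(N))` for `p ∤ N` with respect to the Petersson
product (Diamond–Shurman Thm. 5.5.3: `T_p^* = ⟨p⟩⁻¹ T_p`, and `⟨p⟩ = 1` on `Γ₀(N)`). [cite: DiamondShurman2005, Thm. 5.5.3] -/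
def heckeT_selfAdjoint : Prop :=
  ∀ (p : ℕ) [NeZero p] (hp : p.Prime) (hpN : ¬ p ∣ N) (f g : CuspForm (Gamma0 N) k),
    peterssonProduct (Gamma0 N) k (heckeT (Gamma0 N) k p f) g =
      peterssonProduct (Gamma0 N) k f (heckeT (Gamma0 N) k p g)

/-- The Hecke algebra of `S_k(Γ₁(N))` is commutative (Diamond–Shurman Prop. 5.2.4, §5.3). [cite: DiamondShurman2005, Prop. 5.2.4 and §5.3] -/
def heckeAlgebra_commutative : Prop :=
  ∀ (S T : Module.End ℂ (CuspForm (Gamma1 N) k)) (hS : S ∈ heckeAlgebra (Gamma1 N) k) (hT : T ∈ heckeAlgebra (Gamma1 N) k),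
    S * T = T * S

/-- The Hecke algebra of `S_k(Γ₀(N))` is commutative (Diamond–Shurman Prop. 5.2.4, §5.3). [cite: DiamondShurman2005, Prop. 5.2.4 and §5.3] -/
def heckeAlgebra_commutative_gamma0 : Prop :=
  ∀ (S T : Module.End ℂ (CuspForm (Gamma0 N) k)) (hS : S ∈ heckeAlgebra (Gamma0 N) k) (hT : T ∈ heckeAlgebra (Gamma0 N) k),
    S * T = T * S

end Theorems

end Literature.NumberTheory.EllipticCurves.ModularForms

end
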